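import Summits.Ventures.YMGap.Thresholds.StarSU3PV2DimRows
import Summits.Ventures.YMGap.Thresholds.OneLinkModulusSU3Twisted
import HarnessLib

/-!
# Venture YMGap — `SU(3)` in EVERY dimension `d ≥ 2` on the TWISTED one-link Poincaré constant (PV2T), HYPOTHESIS-FREE:
# `MassGapAt d 3 (β_W/9)` at `(d−1)|β_W| ≤ 23/20`, the small-`d` rows, and track (a) in `d = 3, 4, 5, 6`

HONEST FRAMING: venture file of the cell `pub-ymgap` (QuantumFields programme), seat engine-2 (g11); 0 compute.  Strong-coupling LATTICE statements for
`SU(3)` lattice Yang–Mills on `ℤ^d` (Wilson action; tree coupling `β_W/3`, 't Hooft `β_W/9`); nothing about the continuum; NOT a Yang–Mills mass-gap claim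
in the Clay sense.  WHAT: ds-1's every-`d` socket `StarDimMassGap.massGapAt_of_oneLinkKRModulus` (tilt radius `2(d−1)|β_W|/9`, door `doorPoly d (K|β_W|/9) < 1`)
fed with engine-2 g11's modulus on the TWISTED Poincaré constant `OneLinkModulusSU3Twisted.su3_oneLinkKRModulus_pv2t_of_le` (`0 < K_p`, `K_p + (97/50)R ≤ 12/7`,
`48τ(τ−1) + 27τ³R² ≤ 16(τ−1)K_pK²`).  ROWS (hypothesis-free, class K; before = g10's `StarSU3PV2DimRows` 713800a4255c on Bakry–Émery):
★ every `d ≥ 2`: `(d−1)|β_W| ≤ 23/20` (was `19/20`; one certificate `K = 4829/2500` at radius `23/90`); `d = 3`: `|β_W| ≤ 157/250 = 0.628` (was `53/100`);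
`d = 4`: `51/125 = 0.408` (was `87/250`); `d = 5`: `151/500` (was `1/4`); `d = 6`: `6/25` (was `41/200`); DLR and phase twins; track (a):
`ImprovedThreshold 3 3 (157/2250)`, `4 3 (17/375)`, `5 3 (151/4500)`, `6 3 (2/75)` (were `53/900`, `29/750`, `1/36`, `41/1800`; printed Shen–Zhu–Zhu `1/(16(d−1))`).
NOT CLAIMED: `SU(2)`, `N ≥ 4`, the certified (H1 ∧ H2) column (`d = 3`: `33/40`), sharpness; radii are door artefacts.
Certificates: `HOME/pub-ymgap-engine-2/pv2t/cert_pv2t.{py,json}` (exact rationals; each row ONE `norm_num`).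
-/

noncomputable section

open MeasureTheory ProbabilityTheory Function Finset
open Literature.Probability.LatticeModels
open Literature.MathematicalPhysics.QuantumLattice (fundamentalRep ymSpecification)
open Literature.MathematicalPhysics.QuantumFieldTheory
open Literature.MathematicalPhysics.QuantumFieldTheory.Balaban1983to89
open Literature.MathematicalPhysics.QuantumFieldTheory.Balaban1983to89.StrongCouplingDobrushinWindow
  (OneLinkKRModulus DLRMassGapAt)
open Summit.Ventures.YMGap.StarResolventDim (doorPoly doorPoly_lt_one_mono)
open Summit.Ventures.YMGap.StarSU3Certified (abs_div_nine)
open Summit.Ventures.YMGap.StarSU3PV2Dim (doorPoly_lt_one_of_uniform)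
open Summit.Ventures.YMGap.TwistedBochner (su3_oneLinkKRModulus_pv2t_of_le)

namespace Summit.Ventures.YMGap.StarSU3PV2TDim

variable {d : ℕ}

/-! ### 1. The socket-fed row in dimension `d`, hypothesis-free -/

/-- **`SU(3)`, dimension `d ≥ 2`, HYPOTHESIS-FREE (twisted constant): `MassGapAt d 3 (β_W/9)`, door displayed.**  A modulus radius `R_m` with
`2(d−1)|β_W|/9 ≤ R_m`, `0 < K_p`, `K_p + (97/50)R_m ≤ 12/7`, a multiplier `τ > 1`, a rational `K ≥ 0` with `48τ(τ−1) + 27τ³R_m² ≤ 16(τ−1)K_pK²` and ds-1's door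
`doorPoly d (K|β_W|/9) < 1` give DLR uniqueness + exponential clustering for `SU(3)` at 't Hooft `β_W/9`. [folklore] -/
theorem su3_massGapAt_dim_pv2t (hd : 2 ≤ d) {βW Rm τ K Kp : ℝ} (hR : |βW| / 9 * (2 * ((d : ℝ) - 1)) ≤ Rm) (hKp : 0 < Kp)
    (hKpR : Kp + 97 / 50 * Rm ≤ 12 / 7) (hτ : 1 < τ) (hK0 : 0 ≤ K) (hK : 48 * τ * (τ - 1) + 27 * τ ^ 3 * Rm ^ 2 ≤ 16 * (τ - 1) * (Kp * K ^ 2))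
    (hdoor : doorPoly d (K * (|βW| / 9)) < 1) : MassGapAt d 3 (βW / 9) := by
  refine StarDimMassGap.massGapAt_of_oneLinkKRModulus hd (by norm_num) hK0 ?_ (su3_oneLinkKRModulus_pv2t_of_le hτ hKp hKpR hK0 hK) ?_
  · rw [abs_div_nine]; exact hR
  · rw [abs_div_nine]; exact hdoor

/-! ### 2. ★ Every dimension: `(d−1)|β_W| ≤ 23/20` -/

/-- ★ **`SU(3)`, EVERY DIMENSION `d ≥ 2`, HYPOTHESIS-FREE (twisted constant): `MassGapAt d 3 (β_W/9)` at every Wilson `(d−1)|β_W| ≤ 23/20`** — DLR uniqueness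
on `ℤ^d` and exponential clustering for every DLR state.  One certificate: `K = 4829/2500` (`K_p = 38383/31500`, `τ = 59/50`) at the fixed tilt radius
`23/90 ≥ 2(d−1)|β_W|/9`, and the door through `doorPoly_lt_one_of_uniform` with `a = (23/180)·K` (`4a = 0.9873 < 1`).  Rows: `d = 3`: `|β_W| ≤ 23/40`;
`d = 4`: `23/60`; `d = 5`: `23/80`; large `d`: `1.15/(d−1)` (was `0.95/(d−1)`). [folklore] -/
theorem su3_massGapAt_dim_pv2t_uniform (hd : 2 ≤ d) {βW : ℝ} (h : ((d : ℝ) - 1) * |βW| ≤ 23 / 20) : MassGapAt d 3 (βW / 9) := by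
  have hd' : (2 : ℝ) ≤ d := by exact_mod_cast hd
  have hβ : 0 ≤ |βW| := abs_nonneg βW
  refine su3_massGapAt_dim_pv2t hd (Rm := 23 / 90) (τ := 59 / 50) (K := 4829 / 2500) (Kp := 38383 / 31500) (by linarith) (by norm_num) (by norm_num)
    (by norm_num) (by norm_num) (by norm_num) ?_
  refine doorPoly_lt_one_of_uniform hd (a := 23 / 180 * (4829 / 2500)) (by positivity) ?_ (by norm_num) (by norm_num)
  nlinarith

/-- ★ The same row in the SC-a currency: `DLRMassGapAt d 3 (β_W/9)` at every `(d−1)|β_W| ≤ 23/20`, every `d ≥ 2`, hypothesis-free. [folklore] -/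
theorem su3_dlrMassGapAt_dim_pv2t_uniform (hd : 2 ≤ d) {βW : ℝ} (h : ((d : ℝ) - 1) * |βW| ≤ 23 / 20) : DLRMassGapAt d 3 (βW / 9) :=
  massGapAt_iff_dlrMassGapAt.1 (su3_massGapAt_dim_pv2t_uniform hd h)

/-! ### 3. Small-`d` rows at their own radii -/

/-- **`SU(3)`, `d = 3`, HYPOTHESIS-FREE (twisted constant): `MassGapAt 3 3 (β_W/9)` at every Wilson `|β_W| ≤ 157/250 = 0.628`** (`K(314/1125) = 4019/2000`,
`K_p = 230897/196875`, `τ = 597/500`; door `8c² + 6c = 0.9986 < 1`; was `53/100`; the conditional H1 ∧ H2 row reads `33/40`). [folklore] -/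
theorem su3_three_massGapAt_pv2t {βW : ℝ} (h : |βW| ≤ 157 / 250) : MassGapAt 3 3 (βW / 9) := by
  have hβ : 0 ≤ |βW| := abs_nonneg βW
  refine su3_massGapAt_dim_pv2t (by norm_num) (Rm := 314 / 1125) (τ := 597 / 500) (K := 4019 / 2000) (Kp := 230897 / 196875) (by push_cast; linarith)
    (by norm_num) (by norm_num) (by norm_num) (by norm_num) (by norm_num) ?_
  exact doorPoly_lt_one_mono (by norm_num) (by positivity) (by linarith : 4019 / 2000 * (|βW| / 9) ≤ 4019 / 2000 * ((157 / 250 : ℝ) / 9))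
    (by unfold doorPoly; norm_num)

/-- **`SU(3)`, `d = 4`, HYPOTHESIS-FREE (twisted constant): `MassGapAt 4 3 (β_W/9)` at every Wilson `|β_W| ≤ 51/125 = 0.408`** (`K(34/125) = 9927/5000`,
`K_p = 25957/21875`, `τ = 119/100`; door `12c² + 10c = 0.9973`; was `87/250 = 0.348`). [folklore] -/
theorem su3_four_massGapAt_pv2t {βW : ℝ} (h : |βW| ≤ 51 / 125) : MassGapAt 4 3 (βW / 9) := by
  have hβ : 0 ≤ |βW| := abs_nonneg βW
  refine su3_massGapAt_dim_pv2t (by norm_num) (Rm := 34 / 125) (τ := 119 / 100) (K := 9927 / 5000) (Kp := 25957 / 21875) (by push_cast; linarith)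
    (by norm_num) (by norm_num) (by norm_num) (by norm_num) (by norm_num) ?_
  exact doorPoly_lt_one_mono (by norm_num) (by positivity) (by linarith : 9927 / 5000 * (|βW| / 9) ≤ 9927 / 5000 * ((51 / 125 : ℝ) / 9))
    (by unfold doorPoly; norm_num)

/-- **`SU(3)`, `d = 5`, HYPOTHESIS-FREE (twisted constant): `MassGapAt 5 3 (β_W/9)` at every Wilson `|β_W| ≤ 151/500`** (`K(302/1125) = 2467/1250`,
`K_p = 234971/196875`, `τ = 297/250`; door `16c² + 14c = 0.9973`; was `1/4`). [folklore] -/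
theorem su3_five_massGapAt_pv2t {βW : ℝ} (h : |βW| ≤ 151 / 500) : MassGapAt 5 3 (βW / 9) := by
  have hβ : 0 ≤ |βW| := abs_nonneg βW
  refine su3_massGapAt_dim_pv2t (by norm_num) (Rm := 302 / 1125) (τ := 297 / 250) (K := 2467 / 1250) (Kp := 234971 / 196875) (by push_cast; linarith)
    (by norm_num) (by norm_num) (by norm_num) (by norm_num) (by norm_num) ?_
  exact doorPoly_lt_one_mono (by norm_num) (by positivity) (by linarith : 2467 / 1250 * (|βW| / 9) ≤ 2467 / 1250 * ((151 / 500 : ℝ) / 9))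
    (by unfold doorPoly; norm_num)

/-- **`SU(3)`, `d = 6`, HYPOTHESIS-FREE (twisted constant): `MassGapAt 6 3 (β_W/9)` at every Wilson `|β_W| ≤ 6/25`** (`K(4/15) = 19677/10000`, `K_p = 3142/2625`,
`τ = 297/250`; door `20c² + 18c = 0.9996`; was `41/200`). [folklore] -/
theorem su3_six_massGapAt_pv2t {βW : ℝ} (h : |βW| ≤ 6 / 25) : MassGapAt 6 3 (βW / 9) := by
  have hβ : 0 ≤ |βW| := abs_nonneg βW
  refine su3_massGapAt_dim_pv2t (by norm_num) (Rm := 4 / 15) (τ := 297 / 250) (K := 19677 / 10000) (Kp := 3142 / 2625) (by push_cast; linarith)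
    (by norm_num) (by norm_num) (by norm_num) (by norm_num) (by norm_num) ?_
  exact doorPoly_lt_one_mono (by norm_num) (by positivity) (by linarith : 19677 / 10000 * (|βW| / 9) ≤ 19677 / 10000 * ((6 / 25 : ℝ) / 9))
    (by unfold doorPoly; norm_num)

/-- The `d = 3` row in the SC-a currency: `DLRMassGapAt 3 3 (β_W/9)` at every `|β_W| ≤ 157/250`, hypothesis-free. [folklore] -/
theorem su3_three_dlrMassGapAt_pv2t {βW : ℝ} (h : |βW| ≤ 157 / 250) : DLRMassGapAt 3 3 (βW / 9) :=
  massGapAt_iff_dlrMassGapAt.1 (su3_three_massGapAt_pv2t h)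

/-- The `d = 4` row in the SC-a currency: `DLRMassGapAt 4 3 (β_W/9)` at every `|β_W| ≤ 51/125`, hypothesis-free. [folklore] -/
theorem su3_four_dlrMassGapAt_pv2t {βW : ℝ} (h : |βW| ≤ 51 / 125) : DLRMassGapAt 4 3 (βW / 9) :=
  massGapAt_iff_dlrMassGapAt.1 (su3_four_massGapAt_pv2t h)

/-- The `d = 3` row as p2's strong-coupling PHASE predicate `HessianSharp.StrongCouplingPhaseAt 3 3 (β_W/3)` at every `|β_W| ≤ 157/250`, hypothesis-free. [folklore] -/
theorem su3_three_strongCouplingPhaseAt_pv2t {βW : ℝ} (h : |βW| ≤ 157 / 250) : HessianSharp.StrongCouplingPhaseAt 3 3 (βW / 3) := by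
  refine HessianSharp.strongCouplingPhaseAt_of_massGapAt (by norm_num) (by norm_num) ?_
  have e : βW / 3 / ((3 : ℕ) : ℝ) = βW / 9 := by push_cast; ring
  rw [e]
  exact su3_three_massGapAt_pv2t h

/-- The `d = 4` row as the PHASE predicate `HessianSharp.StrongCouplingPhaseAt 4 3 (β_W/3)` at every `|β_W| ≤ 51/125`, hypothesis-free. [folklore] -/
theorem su3_four_strongCouplingPhaseAt_pv2t {βW : ℝ} (h : |βW| ≤ 51 / 125) : HessianSharp.StrongCouplingPhaseAt 4 3 (βW / 3) := by
  refine HessianSharp.strongCouplingPhaseAt_of_massGapAt (by norm_num) (by norm_num) ?_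
  have e : βW / 3 / ((3 : ℕ) : ℝ) = βW / 9 := by push_cast; ring
  rw [e]
  exact su3_four_massGapAt_pv2t h

/-! ### 4. Track (a) in dimensions 3, 4, 5, 6 -/

/-- **`ImprovedThreshold 3 3 (157/2250)`, HYPOTHESIS-FREE** (`SU(3)`, `d = 3`: mass gap at every 't Hooft `|x| < 157/2250 = 0.0698`, Wilson `β_W < 0.628`;
was `53/900`; Shen–Zhu–Zhu `1/32`). [folklore] -/
theorem improvedThreshold_su3_three_pv2t : ImprovedThreshold 3 3 (157 / 2250) :=
  ⟨by norm_num, fun x hx => by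
    have h := su3_three_massGapAt_pv2t (βW := 9 * x) (by rw [abs_mul, abs_of_pos (by norm_num : (0 : ℝ) < 9)]; linarith [hx.le])
    rwa [show 9 * x / 9 = x by ring] at h⟩

/-- **`ImprovedThreshold 4 3 (17/375)`, HYPOTHESIS-FREE** (`SU(3)`, `d = 4`: `17/375 = 0.04533`, Wilson `β_W < 0.408`; was `29/750 = 0.03867`; the sibling
`OneLinkModulusSU3Twisted.improvedThreshold_su3_pv2t` reads `9/200` through ds-1's `4K|x| ≤ 9/25` form; Shen–Zhu–Zhu `1/48`). [folklore] -/
theorem improvedThreshold_su3_four_pv2t : ImprovedThreshold 4 3 (17 / 375) :=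
  ⟨by norm_num, fun x hx => by
    have h := su3_four_massGapAt_pv2t (βW := 9 * x) (by rw [abs_mul, abs_of_pos (by norm_num : (0 : ℝ) < 9)]; linarith [hx.le])
    rwa [show 9 * x / 9 = x by ring] at h⟩

/-- **`ImprovedThreshold 5 3 (151/4500)`, HYPOTHESIS-FREE** (`SU(3)`, `d = 5`: Wilson `β_W < 151/500`; was `1/36`; Shen–Zhu–Zhu `1/64`). [folklore] -/
theorem improvedThreshold_su3_five_pv2t : ImprovedThreshold 5 3 (151 / 4500) :=
  ⟨by norm_num, fun x hx => by
    have h := su3_five_massGapAt_pv2t (βW := 9 * x) (by rw [abs_mul, abs_of_pos (by norm_num : (0 : ℝ) < 9)]; linarith [hx.le])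
    rwa [show 9 * x / 9 = x by ring] at h⟩

/-- **`ImprovedThreshold 6 3 (2/75)`, HYPOTHESIS-FREE** (`SU(3)`, `d = 6`: Wilson `β_W < 6/25`; was `41/1800`; Shen–Zhu–Zhu `1/80`). [folklore] -/
theorem improvedThreshold_su3_six_pv2t : ImprovedThreshold 6 3 (2 / 75) :=
  ⟨by norm_num, fun x hx => by
    have h := su3_six_massGapAt_pv2t (βW := 9 * x) (by rw [abs_mul, abs_of_pos (by norm_num : (0 : ℝ) < 9)]; linarith [hx.le])
    rwa [show 9 * x / 9 = x by ring] at h⟩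

end Summit.Ventures.YMGap.StarSU3PV2TDim

end
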